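import Summits.CriticalPhenomena.SAWScalingLimit.Theorems.SAWLeftRightFKGFKGToTraversalBoundObstacleOneSided
import Summits.CriticalPhenomena.SAWScalingLimit.Theorems.SAWLeftRightFKGFKGToTraversalBoundObstacleTriplePockets
import HarnessLib

/-!
# Witness glue T5, part 1: the closed walk through a far piece and one-sidedness of its contacts

Crux `SAWLeftRightFKG.FKGToTraversalBound` (stmt-CriticalPhenomena-1878), line `slit-necklace`, lead
prover-line-stmt-CriticalPhenomena-1878-c5-0; witness glue unit T5 (block-monotone contact index on a far piece
along the outline arc), part 1 of 4.

Abstract setting of `obstacle_oneSided` (…ObstacleOneSided.lean): `A ⊆ ℤ²` finite and `4`-connected, `r` a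
lattice PATH of length `≥ 2` off `A` (the obstacle: a far piece of the chord), `Rbig` an abscissa exceeding that
of every site of `A ∪ r` by `2`, and ESCAPES `εu : u ⟶ u₁`, `εv : v ⟶ v₁` from the two endpoints of `r` avoiding
`A` and the interior vertices of `r`, ending at abscissa `≥ Rbig`.  We build the closed lattice walk
`J = r · εv · κ · εu⁻¹`, where the far connector `κ : v₁ ⟶ u₁` stays at abscissa `≥ Rbig` (`mono_farWalk`), check
that `J` uses every edge of `r` exactly once and no other edge at the interior vertices of `r`
(`mono_closedWalk`), and conclude from `obstacle_oneSided` that all contacts of `A` with `r` are of LEFT type or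
all are of RIGHT type (`mono_oneSided`, the registered part).  Also: straight lattice walks (`mono_eastWalk`,
`mono_northWalk`) reused by the escape constructions of part 3.

All statements folklore lattice combinatorics; no literature fact; nothing restates the crux.
-/

noncomputable section

open Literature.Probability.LatticeModels

namespace Summit.CriticalPhenomena.SAWScalingLimit.Theorems.FKGToTraversalBound.SlitNecklace

/-! ### Straight lattice walks -/

/-- **Walking east.**  From `a`, `k` unit steps east: a lattice walk ending at abscissa `a 0 + k` on the row of
`a`, all of whose sites lie on that row at abscissa `≥ a 0`. [folklore] -/
theorem mono_eastWalk (a : Site 2) (k : ℕ) :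
    ∃ (b : Site 2) (w : (zdGraph 2).Walk a b), b 0 = a 0 + k ∧ b 1 = a 1 ∧
      ∀ z ∈ w.support, a 0 ≤ z 0 ∧ z 1 = a 1 := by
  induction k with
  | zero =>
    refine ⟨a, SimpleGraph.Walk.nil, by simp, rfl, ?_⟩
    intro z hz
    rw [SimpleGraph.Walk.support_nil, List.mem_singleton] at hz
    subst hz
    exact ⟨le_rfl, rfl⟩
  | succ k ih =>
    obtain ⟨b, w, hb0, hb1, hw⟩ := ih
    have hadj : (zdGraph 2).Adj b (b + Pi.single 0 1) := (zdGraph_adj_iff _ _).2 ⟨0, Or.inl rfl⟩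
    have e0 : (b + Pi.single 0 1 : Site 2) 0 = b 0 + 1 := by simp
    have e1 : (b + Pi.single 0 1 : Site 2) 1 = b 1 := by simp
    refine ⟨b + Pi.single 0 1, w.concat hadj, ?_, ?_, ?_⟩
    · rw [e0, hb0]; push_cast; ring
    · rw [e1, hb1]
    · intro z hz
      rw [SimpleGraph.Walk.support_concat, List.mem_append, List.mem_singleton] at hz
      rcases hz with hz | rfl
      · exact hw z hz
      · rw [e0, e1, hb1, hb0]
        exact ⟨by omega, rfl⟩

/-- **Walking north.**  From `a`, `k` unit steps north: a lattice walk ending at ordinate `a 1 + k` on the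
column of `a`, all of whose sites lie on that column. [folklore] -/
theorem mono_northWalk (a : Site 2) (k : ℕ) :
    ∃ (b : Site 2) (w : (zdGraph 2).Walk a b), b 1 = a 1 + k ∧ b 0 = a 0 ∧ ∀ z ∈ w.support, z 0 = a 0 := by
  induction k with
  | zero =>
    refine ⟨a, SimpleGraph.Walk.nil, by simp, rfl, ?_⟩
    intro z hz
    rw [SimpleGraph.Walk.support_nil, List.mem_singleton] at hz
    rw [hz]
  | succ k ih =>
    obtain ⟨b, w, hb1, hb0, hw⟩ := ih
    have hadj : (zdGraph 2).Adj b (b + Pi.single 1 1) := (zdGraph_adj_iff _ _).2 ⟨1, Or.inl rfl⟩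
    have e0 : (b + Pi.single 1 1 : Site 2) 0 = b 0 := by simp
    have e1 : (b + Pi.single 1 1 : Site 2) 1 = b 1 + 1 := by simp
    refine ⟨b + Pi.single 1 1, w.concat hadj, ?_, ?_, ?_⟩
    · rw [e1, hb1]; push_cast; ring
    · rw [e0, hb0]
    · intro z hz
      rw [SimpleGraph.Walk.support_concat, List.mem_append, List.mem_singleton] at hz
      rcases hz with hz | rfl
      · exact hw z hz
      · rw [e0, hb0]

/-- **Far connector.**  Two sites of abscissa `≥ R` are joined by a lattice walk all of whose sites have
abscissa `≥ R` (east to a common column, then along it). [folklore] -/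
theorem mono_farWalk (a b : Site 2) (R : ℤ) (ha : R ≤ a 0) (hb : R ≤ b 0) :
    ∃ w : (zdGraph 2).Walk a b, ∀ z ∈ w.support, R ≤ z 0 := by
  -- east to the common column `X`
  set X : ℤ := max (a 0) (b 0) with hX
  obtain ⟨a', wa, ha'0, ha'1, hwa⟩ := mono_eastWalk a (X - a 0).toNat
  obtain ⟨b', wb, hb'0, hb'1, hwb⟩ := mono_eastWalk b (X - b 0).toNat
  have hXa : a' 0 = X := by rw [ha'0, Int.toNat_of_nonneg (by omega)]; ring
  have hXb : b' 0 = X := by rw [hb'0, Int.toNat_of_nonneg (by omega)]; ring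
  have hwa' : ∀ z ∈ wa.support, R ≤ z 0 := fun z hz => ha.trans (hwa z hz).1
  have hwb' : ∀ z ∈ wb.reverse.support, R ≤ z 0 := fun z hz => by
    rw [SimpleGraph.Walk.support_reverse, List.mem_reverse] at hz
    exact hb.trans (hwb z hz).1
  -- along the column
  have vert : ∀ (p q : Site 2), p 0 = X → q 0 = X → p 1 ≤ q 1 →
      ∃ w : (zdGraph 2).Walk p q, ∀ z ∈ w.support, R ≤ z 0 := by
    intro p q hp hq hpq
    obtain ⟨q', wv, hq'1, hq'0, hwv⟩ := mono_northWalk p (q 1 - p 1).toNat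
    have hqq : q' = q := by
      rw [Site.eq_iff_two]
      refine ⟨by rw [hq'0, hp, hq], ?_⟩
      rw [hq'1, Int.toNat_of_nonneg (by omega)]; ring
    refine ⟨wv.copy rfl hqq, fun z hz => ?_⟩
    rw [SimpleGraph.Walk.support_copy] at hz
    rw [hwv z hz, hp]
    exact ha.trans (le_max_left _ _)
  rcases le_total (a' 1) (b' 1) with h | h
  · obtain ⟨wv, hwv⟩ := vert a' b' hXa hXb h
    refine ⟨wa.append (wv.append wb.reverse), fun z hz => ?_⟩
    rw [SimpleGraph.Walk.mem_support_append_iff, SimpleGraph.Walk.mem_support_append_iff] at hz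
    rcases hz with hz | hz | hz
    exacts [hwa' z hz, hwv z hz, hwb' z hz]
  · obtain ⟨wv, hwv⟩ := vert b' a' hXb hXa h
    refine ⟨wa.append (wv.reverse.append wb.reverse), fun z hz => ?_⟩
    rw [SimpleGraph.Walk.mem_support_append_iff, SimpleGraph.Walk.mem_support_append_iff,
      SimpleGraph.Walk.support_reverse, List.mem_reverse] at hz
    rcases hz with hz | hz | hz
    exacts [hwa' z hz, hwv z hz, hwb' z hz]

/-! ### Edges of a lattice path -/

/-- The `m`-th edge of a walk is one of its edges. [folklore] -/
theorem mono_edge_mem {a b : Site 2} (p : (zdGraph 2).Walk a b) {m : ℕ} (hm : m < p.length) :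
    s(p.getVert m, p.getVert (m + 1)) ∈ p.edges := by
  induction p generalizing m with
  | nil => simp at hm
  | cons h q ih =>
    cases m with
    | zero =>
      rw [SimpleGraph.Walk.edges_cons, List.mem_cons]
      left
      simp only [SimpleGraph.Walk.getVert_zero, zero_add, SimpleGraph.Walk.getVert_cons_succ]
    | succ m =>
      simp only [SimpleGraph.Walk.getVert_cons_succ, SimpleGraph.Walk.edges_cons, List.mem_cons]
      refine Or.inr (ih ?_)
      rw [SimpleGraph.Walk.length_cons] at hm
      omega

/-- In a path, the edge `{p_m, p_{m+1}}` occurs exactly once. [folklore] -/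
theorem mono_count_edge_eq_one {a b : Site 2} {p : (zdGraph 2).Walk a b} (hp : p.IsPath) {m : ℕ}
    (hm : m < p.length) : p.edges.count s(p.getVert m, p.getVert (m + 1)) = 1 :=
  List.count_eq_one_of_mem hp.isTrail.edges_nodup (mono_edge_mem p hm)

/-- An edge of a path through the interior vertex `p_m` is one of the two path edges at `p_m`. [folklore] -/
theorem mono_edge_at {a b : Site 2} {p : (zdGraph 2).Walk a b} (hp : p.IsPath) {m : ℕ} (hm0 : 0 < m)
    (hmL : m < p.length) {e : Sym2 (Site 2)} (he : e ∈ p.edges) (hme : p.getVert m ∈ e) :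
    e = s(p.getVert (m - 1), p.getVert m) ∨ e = s(p.getVert m, p.getVert (m + 1)) := by
  induction e using Sym2.ind with
  | h x y =>
    obtain ⟨k, hk, hcase⟩ := triple_mem_edges p he
    have hinj := hp.getVert_injOn
    have key : ∀ x' y', p.getVert k = x' → p.getVert (k + 1) = y' → (p.getVert m = x' ∨ p.getVert m = y') →
        s(x', y') = s(p.getVert (m - 1), p.getVert m) ∨ s(x', y') = s(p.getVert m, p.getVert (m + 1)) := by
      rintro x' y' rfl rfl (h | h)
      · have : m = k := hinj (by simp only [Set.mem_setOf_eq]; omega)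
          (by simp only [Set.mem_setOf_eq]; omega) h
        subst this
        exact Or.inr rfl
      · have : m = k + 1 := hinj (by simp only [Set.mem_setOf_eq]; omega)
          (by simp only [Set.mem_setOf_eq]; omega) h
        subst this
        rw [Nat.add_sub_cancel]
        exact Or.inl rfl
    rcases hcase with ⟨hx, hy⟩ | ⟨hy, hx⟩
    · exact key x y hx hy (Sym2.mem_iff.1 hme)
    · rw [Sym2.eq_swap]
      exact key y x hy hx ((Sym2.mem_iff.1 hme).symm)

/-! ### The closed walk through the obstacle -/

/-- **The closed walk `J = r · εv · κ · εu⁻¹`.**  For a lattice path `r : u ⟶ v` of length `≥ 2`, an abscissa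
`Rbig` exceeding that of every site of `r` by `2`, and walks `εu : u ⟶ u₁`, `εv : v ⟶ v₁` avoiding the interior
vertices of `r` with `u₁ 0, v₁ 0 ≥ Rbig`: there is a closed lattice walk `J` from `u` whose sites are sites of
`r`, of `εu`, of `εv` or of abscissa `≥ Rbig`, which uses every edge of `r` exactly once, and whose only edges
at an interior vertex of `r` are the two `r`-edges there. [folklore] -/
theorem mono_closedWalk {u v u₁ v₁ : Site 2} (r : (zdGraph 2).Walk u v) (hr : r.IsPath) (hL : 2 ≤ r.length)
    (Rbig : ℤ) (εu : (zdGraph 2).Walk u u₁) (εv : (zdGraph 2).Walk v v₁)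
    (hR : ∀ z ∈ r.support, z 0 + 2 ≤ Rbig) (hu₁ : Rbig ≤ u₁ 0) (hv₁ : Rbig ≤ v₁ 0)
    (hεu : ∀ z ∈ εu.support, ∀ n, 0 < n → n < r.length → z ≠ r.getVert n)
    (hεv : ∀ z ∈ εv.support, ∀ n, 0 < n → n < r.length → z ≠ r.getVert n) :
    ∃ J : (zdGraph 2).Walk u u,
      (∀ z ∈ J.support, z ∈ r.support ∨ z ∈ εu.support ∨ z ∈ εv.support ∨ Rbig ≤ z 0) ∧
      (∀ m, m < r.length → J.edges.count s(r.getVert m, r.getVert (m + 1)) = 1) ∧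
      (∀ m, 0 < m → m < r.length → ∀ e ∈ J.edges, r.getVert m ∈ e →
        e = s(r.getVert (m - 1), r.getVert m) ∨ e = s(r.getVert m, r.getVert (m + 1))) := by
  obtain ⟨κ, hκ⟩ := mono_farWalk v₁ u₁ Rbig hv₁ hu₁
  -- the return walk `W = εv · κ · εu⁻¹` avoids the interior vertices of `r`
  set W : (zdGraph 2).Walk v u := εv.append (κ.append εu.reverse) with hWdef
  have hWs : ∀ z ∈ W.support, z ∈ εu.support ∨ z ∈ εv.support ∨ Rbig ≤ z 0 := by
    intro z hz
    rw [hWdef, SimpleGraph.Walk.mem_support_append_iff, SimpleGraph.Walk.mem_support_append_iff,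
      SimpleGraph.Walk.support_reverse, List.mem_reverse] at hz
    rcases hz with hz | hz | hz
    exacts [Or.inr (Or.inl hz), Or.inr (Or.inr (hκ z hz)), Or.inl hz]
  have hWint : ∀ z ∈ W.support, ∀ n, 0 < n → n < r.length → z ≠ r.getVert n := by
    intro z hz n hn0 hnL
    rcases hWs z hz with h | h | h
    · exact hεu z h n hn0 hnL
    · exact hεv z h n hn0 hnL
    · intro heq
      have := hR _ (r.getVert_mem_support n)
      rw [← heq] at this
      omega
  -- no edge of `W` is an edge of `r`
  have hWe : ∀ m, m < r.length → s(r.getVert m, r.getVert (m + 1)) ∉ W.edges := by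
    intro m hm hmem
    rcases Nat.eq_zero_or_pos m with rfl | hm0
    · exact hWint _ (W.snd_mem_support_of_mem_edges hmem) 1 one_pos (by omega) rfl
    · exact hWint _ (W.fst_mem_support_of_mem_edges hmem) m hm0 hm rfl
  refine ⟨r.append W, ?_, ?_, ?_⟩
  · intro z hz
    rw [SimpleGraph.Walk.mem_support_append_iff] at hz
    rcases hz with hz | hz
    · exact Or.inl hz
    · exact Or.inr (hWs z hz)
  · intro m hm
    rw [SimpleGraph.Walk.edges_append, List.count_append, mono_count_edge_eq_one hr hm,
      List.count_eq_zero.2 (hWe m hm)]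
  · intro m hm0 hmL e he hme
    rw [SimpleGraph.Walk.edges_append, List.mem_append] at he
    rcases he with he | he
    · exact mono_edge_at hr hm0 hmL he hme
    · exfalso
      induction e using Sym2.ind with
      | h x y =>
        rcases Sym2.mem_iff.1 hme with rfl | rfl
        · exact hWint _ (W.fst_mem_support_of_mem_edges he) m hm0 hmL rfl
        · exact hWint _ (W.snd_mem_support_of_mem_edges he) m hm0 hmL rfl

/-! ### The registered part -/

/-- **Witness glue T5, part 1 (registered): one-sidedness of the contacts of the free component with a far
piece, from escapes.**  `A` finite `4`-connected, `r : u ⟶ v` a lattice path of length `≥ 2` off `A`, `Rbig`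
beyond every site of `A ∪ r` by `2`, escapes `εu`, `εv` from `u`, `v` off `A` and off the interior of `r` to
abscissa `≥ Rbig`.  Then every contact `r_m = f + vec d` (`f ∈ A`, `0 < m < |r|`) is of LEFT type, or every
contact is of RIGHT type: `obstacle_oneSided` applied to the closed walk of `mono_closedWalk`, which is off `A`
(sites of `r`, of the escapes, or of abscissa `≥ Rbig > ` every site of `A`). [folklore] -/
theorem mono_oneSided : ∀ (A : Finset (Site 2)) {u v : Site 2} (r : (zdGraph 2).Walk u v) (Rbig : ℤ) (u₁ v₁ : Site 2) (εu : (zdGraph 2).Walk u u₁) (εv : (zdGraph 2).Walk v v₁), r.IsPath → 2 ≤ r.length → (∀ x ∈ A, ∀ y ∈ A, ∃ w : (zdGraph 2).Walk x y, ∀ z ∈ w.support, z ∈ A) → (∀ z ∈ r.support, z ∉ A) → (∀ z : Site 2, (z ∈ A ∨ z ∈ r.support) → z 0 + 2 ≤ Rbig) → Rbig ≤ u₁ 0 → Rbig ≤ v₁ 0 → (∀ z ∈ εu.support, z ∉ A ∧ ∀ n, 0 < n → n < r.length → z ≠ r.getVert n) → (∀ z ∈ εv.support, z ∉ A ∧ ∀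 n, 0 < n → n < r.length → z ≠ r.getVert n) → (∀ (f : Site 2) (d : ODir) (m : ℕ), f ∈ A → 0 < m → m < r.length → r.getVert m = f + d.vec → (r.getVert (m + 1) = r.getVert m + d.ccw.vec ∨ r.getVert (m - 1) = r.getVert m - d.ccw.vec)) ∨ (∀ (f : Site 2) (d : ODir) (m : ℕ), f ∈ A → 0 < m → m < r.length → r.getVert m = f + d.vec → (r.getVert (m + 1) = r.getVert m - d.ccw.vec ∨ r.getVert (m - 1) = r.getVert m + d.ccw.vec)) := by
  intro A u v r Rbig u₁ v₁ εu εv hr hL hA hrA hR hu₁ hv₁ hεu hεv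
  obtain ⟨J, hJs, hcount, hJr⟩ := mono_closedWalk r hr hL Rbig εu εv (fun z hz => hR z (Or.inr hz)) hu₁ hv₁
    (fun z hz => (hεu z hz).2) (fun z hz => (hεv z hz).2)
  refine obstacle_oneSided A r J hr hL hA (fun z hz hzA => ?_) hcount hJr
  rcases hJs z hz with h | h | h | h
  · exact hrA z h hzA
  · exact (hεu z h).1 hzA
  · exact (hεv z h).1 hzA
  · have := hR z (Or.inl hzA); omega

end Summit.CriticalPhenomena.SAWScalingLimit.Theorems.FKGToTraversalBound.SlitNecklace

end
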